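import Summits.Ventures.HSemireg.WedgeHankelRecurrenceGaussZerosMeanBound

/-!
# Venture HSemireg — **PERRON–FROBENIUS SIGN BALANCE OF THE ZEROS**: if all diagonal coefficients `a_i ≥ 0` (`i ≤ t`), the largest zero of `q_{t+1}` dominates the smallest in absolute value,
# `−x_0 ≤ x_t` (i.e. `x_0 + x_t ≥ 0`); if all `a_i ≤ 0`, then `x_t ≤ −x_0` — the symmetrised Jacobi matrix `tridiag(√b, a, √b)` is entrywise non-negative, so its spectral radius is its
# largest eigenvalue

HONEST FRAMING. Part of the Lean index of the computation cell `pub-hsemireg` (seat p10 gen 45, Sunday typer «UNIFORM-IN-n»).  Real polynomials and finite sums only; no variety, no cohomology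
theory, no sheaf, no Ext group and no semiregularity map is constructed here; nothing here says that HC / HC_CM / HC_AV holds; no Literature fact (unproved `Prop`) is declared or used.  Custodian
versions as in `WedgeHankelSiegelIdeal` (1/3).
SOURCES (cited).  O. Perron, Math. Ann. 64 (1907) 248–263; G. Frobenius, S.-B. Preuss. Akad. (1912) 456–477; R. A. Horn, C. R. Johnson, *Matrix Analysis* (2nd ed.) Thm 8.3.1 ∕ Cor. 8.1.20
(for `A ≥ 0` entrywise, `ρ(A)` is an eigenvalue and `|λ| ≤ ρ(A)`); for Jacobi matrices M. E. H. Ismail, *Classical and Quantum Orthogonal Polynomials* (2005) §7.2.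
PROOF TYPED HERE (no Perron–Frobenius theory).  In the Favard coordinates (N323) every pairing value `X_{ij} = Σ μ x q_i q_j` is `≥ 0` when `a ≥ 0`, so `−Σ v_i v_j X_{ij} ≤ Σ |v_i||v_j| X_{ij}`:
`−(Σ μ x P_v²) ≤ Σ μ x P_{|v|}²` with equal norms; for the Christoffel–Darboux vector at `x_0` (N325 `cd_vector_eval_eq_zero`) the left side is `−x_0 Σ h v²`, and the right side is
`≤ x_t Σ h v²` (N301).  The case `a ≤ 0` by the reflection `a ↦ −a` (N325 `recurrence_reflect_spec`).
DEDUP DISCLOSURE (`rg -n 'perron_balance|abs_le_top|spectral_radius' Summits/Ventures/HSemireg`, 2026-09-03): nothing; N340 (`a ≡ 0`: `x_k = −x_{t−k}`) is the equality case.  The 3 names below: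
0 hits tree-wide.

WHAT IS IN THE TREE.  N323 `favard_pairing_at_zeros`, `favard_x_pairing`, `weighted_sq_combination_expand`, `favard_norm_sq_combination`; N325 `cd_vector_eval_eq_zero`, `recurrence_reflect_spec`;
N324 `strictMono_neg_comp_rev`; N301 `sum_mul_node_mul_sq_le_last`.
THIS FILE (namespace `Summit.Ventures.HSemireg.Wedge.HankelOuter` continued; CHAINED on N362 (import only); 0 definitions):
* §1128 `favard_x_form_neg_le_abs` (`−Σ μ x P_v² ≤ Σ μ x P_{|v|}²` when `a_i ≥ 0`), **`neg_bottom_zero_le_top_zero`** (`a ≥ 0` on `0..t` ⇒ `−x_0 ≤ x_t`), **`top_zero_le_neg_bottom_zero`**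
  (`a ≤ 0` ⇒ `x_t ≤ −x_0`).
CAVEATS.  Positive recurrences.  Nothing Ext-side.  New names only.
-/

open Module Polynomial
open scoped Matrix Polynomial

namespace Summit.Ventures.HSemireg.Wedge.HankelOuter

/-! ## §1128. Perron–Frobenius balance of the extreme zeros -/

/-- **`−Σ μ x P_v² ≤ Σ μ x P_{|v|}²` when all `a_i ≥ 0`** (Favard pairing at the zeros; `P_v = Σ v_i q_i`, `|v|_i = |v_i|`), and the norms of `v` and `|v|` agree. [this file, §1128] -/
theorem favard_x_form_neg_le_abs {q : ℕ → ℝ[X]} {a b : ℕ → ℝ} (hq0 : q 0 = 1) (hq1 : q 1 = Polynomial.X - C (a 0))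
    (hrec : ∀ n, q (n + 2) = (Polynomial.X - C (a (n + 1))) * q (n + 1) - C (b (n + 1)) * q n) (hb : ∀ j, 0 < b j)
    {t : ℕ} (ha : ∀ i, i ≤ t → 0 ≤ a i) {μ x : Fin (t + 1) → ℝ} (hxr : ∀ k, (q (t + 1)).eval (x k) = 0)
    (hpair : ∀ i j : Fin (t + 1), ∑ k, μ k * ((q i).eval (x k) * (q j).eval (x k)) = if i = j then ∏ l ∈ Finset.Ico 1 ((j : ℕ) + 1), b l else 0) (v : Fin (t + 1) → ℝ) :
    -∑ k, μ k * (x k * ((∑ i : Fin (t + 1), C (v i) * q i).eval (x k)) ^ 2) ≤ ∑ k, μ k * (x k * ((∑ i : Fin (t + 1), C (|v i|) * q i).eval (x k)) ^ 2) ∧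
    ∑ k, μ k * ((∑ i : Fin (t + 1), C (|v i|) * q i).eval (x k)) ^ 2 = ∑ k, μ k * ((∑ i : Fin (t + 1), C (v i) * q i).eval (x k)) ^ 2 := by
  have hev : ∀ (w : Fin (t + 1) → ℝ) (z : ℝ), (∑ i : Fin (t + 1), C (w i) * q i).eval z = ∑ i : Fin (t + 1), w i * (q i).eval z := fun w z => by
    rw [eval_finsetSum]; exact Finset.sum_congr rfl fun i _ => by rw [eval_mul, eval_C]
  -- the pairing values are non-negative
  have hX : ∀ i j : Fin (t + 1), 0 ≤ ∑ k, μ k * (x k * ((q i).eval (x k) * (q j).eval (x k))) := fun i j => by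
    rw [favard_x_pairing hq0 hq1 hrec hxr hpair i j]
    refine add_nonneg (add_nonneg ?_ ?_) ?_
    · split_ifs
      · exact Finset.prod_nonneg fun l _ => (hb l).le
      · exact le_rfl
    · split_ifs
      · exact mul_nonneg (ha i (Nat.lt_succ_iff.1 i.is_lt)) (Finset.prod_nonneg fun l _ => (hb l).le)
      · exact le_rfl
    · split_ifs
      · exact Finset.prod_nonneg fun l _ => (hb l).le
      · exact le_rfl
  refine ⟨?_, ?_⟩
  · simp_rw [hev]
    rw [weighted_sq_combination_expand μ x (fun (i : Fin (t + 1)) k => (q i).eval (x k)) v, weighted_sq_combination_expand μ x (fun (i : Fin (t + 1)) k => (q i).eval (x k)) (fun i => |v i|),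
      ← Finset.sum_neg_distrib]
    refine Finset.sum_le_sum fun i _ => ?_
    rw [← Finset.sum_neg_distrib]
    refine Finset.sum_le_sum fun j _ => ?_
    rw [← abs_mul, neg_le]
    calc -(|v i * v j| * ∑ k, μ k * (x k * ((q i).eval (x k) * (q j).eval (x k)))) = (-|v i * v j|) * ∑ k, μ k * (x k * ((q i).eval (x k) * (q j).eval (x k))) := by ring
      _ ≤ (v i * v j) * ∑ k, μ k * (x k * ((q i).eval (x k) * (q j).eval (x k))) := mul_le_mul_of_nonneg_right (neg_abs_le _) (hX i j)
  · rw [favard_norm_sq_combination (h := fun n => ∏ l ∈ Finset.Ico 1 (n + 1), b l) hpair, favard_norm_sq_combination (h := fun n => ∏ l ∈ Finset.Ico 1 (n + 1), b l) hpair]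
    exact Finset.sum_congr rfl fun i _ => by rw [sq_abs]

/-- **PERRON–FROBENIUS BALANCE: `a_i ≥ 0` for `i ≤ t` ⇒ `−x_0 ≤ x_t`** for the zeros `x_0 < ⋯ < x_t` of `q_{t+1}`. [Horn–Johnson Thm 8.3.1 ∕ Cor. 8.1.20; this file, §1128] -/
theorem neg_bottom_zero_le_top_zero {q : ℕ → ℝ[X]} {a b : ℕ → ℝ} (hq0 : q 0 = 1) (hq1 : q 1 = Polynomial.X - C (a 0))
    (hrec : ∀ n, q (n + 2) = (Polynomial.X - C (a (n + 1))) * q (n + 1) - C (b (n + 1)) * q n) (hb : ∀ j, 0 < b j)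
    {t : ℕ} (ha : ∀ i, i ≤ t → 0 ≤ a i) {x : Fin (t + 1) → ℝ} (hx : StrictMono x) (hxq : q (t + 1) = ∏ j, (Polynomial.X - C (x j))) :
    -x 0 ≤ x (Fin.last t) := by
  obtain ⟨μ, hμ, hpair⟩ := favard_pairing_at_zeros hq0 hq1 hrec hb hx hxq
  have hxr : ∀ j, (q (t + 1)).eval (x j) = 0 := fun j => by
    rw [hxq, eval_prod]; exact Finset.prod_eq_zero (Finset.mem_univ j) (by rw [eval_sub, eval_X, eval_C, sub_self])
  -- the Christoffel–Darboux vector at `x_0`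
  obtain ⟨v, hv⟩ : ∃ v : Fin (t + 1) → ℝ, v = fun (j : Fin (t + 1)) => (∏ l ∈ Finset.Ico ((j : ℕ) + 1) (t + 1), b l) * (q j).eval (x 0) := ⟨_, rfl⟩
  obtain ⟨P, hP⟩ : ∃ P : ℝ[X], P = ∑ i : Fin (t + 1), C (v i) * q i := ⟨_, rfl⟩
  obtain ⟨R, hR⟩ : ∃ R : ℝ[X], R = ∑ i : Fin (t + 1), C (|v i|) * q i := ⟨_, rfl⟩
  have hPx : ∀ k, k ≠ 0 → P.eval (x k) = 0 := fun k hk => by rw [hP, hv]; exact cd_vector_eval_eq_zero hq0 hq1 hrec hx hxq hk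
  -- `Σ μ x P² = x_0 Σ μ P²`
  have hF : ∑ k, μ k * (x k * (P.eval (x k)) ^ 2) = x 0 * ∑ k, μ k * (P.eval (x k)) ^ 2 := by
    rw [Finset.sum_eq_single (0 : Fin (t + 1)) (fun k _ hk => by rw [hPx k hk]; ring) (fun h => absurd (Finset.mem_univ _) h),
      Finset.sum_eq_single (0 : Fin (t + 1)) (fun k _ hk => by rw [hPx k hk]; ring) (fun h => absurd (Finset.mem_univ _) h)]
    ring
  obtain ⟨hle, hN⟩ := favard_x_form_neg_le_abs hq0 hq1 hrec hb ha hxr hpair v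
  rw [← hP, ← hR] at hle hN
  have hup : ∑ k, μ k * (x k * (R.eval (x k)) ^ 2) ≤ x (Fin.last t) * ∑ k, μ k * (R.eval (x k)) ^ 2 := sum_mul_node_mul_sq_le_last hx (fun k => (hμ k).le) R
  -- the norm is positive: `v_0 = b_1⋯b_t > 0`
  have hG : ∑ k, μ k * (P.eval (x k)) ^ 2 = ∑ i : Fin (t + 1), (∏ l ∈ Finset.Ico 1 ((i : ℕ) + 1), b l) * v i ^ 2 := by
    rw [hP]; exact favard_norm_sq_combination (h := fun n => ∏ l ∈ Finset.Ico 1 (n + 1), b l) hpair v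
  have hGpos : 0 < ∑ k, μ k * (P.eval (x k)) ^ 2 := by
    rw [hG]
    refine Finset.sum_pos' (fun i _ => mul_nonneg (Finset.prod_nonneg fun l _ => (hb l).le) (sq_nonneg _)) ⟨0, Finset.mem_univ _, mul_pos (Finset.prod_pos fun l _ => hb l) (pow_pos ?_ 2)⟩
    rw [hv]
    dsimp only
    rw [Fin.val_zero, show ((0 : ℕ) : ℕ) = 0 from rfl, hq0, eval_one, mul_one]
    exact Finset.prod_pos fun l _ => hb l
  rw [hF] at hle
  rw [hN] at hup
  have h : -x 0 * ∑ k, μ k * (P.eval (x k)) ^ 2 ≤ x (Fin.last t) * ∑ k, μ k * (P.eval (x k)) ^ 2 := by linarith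
  exact le_of_mul_le_mul_right h hGpos

/-- **Mirror statement: `a_i ≤ 0` for `i ≤ t` ⇒ `x_t ≤ −x_0`.** [this file, §1128] -/
theorem top_zero_le_neg_bottom_zero {q : ℕ → ℝ[X]} {a b : ℕ → ℝ} (hq0 : q 0 = 1) (hq1 : q 1 = Polynomial.X - C (a 0))
    (hrec : ∀ n, q (n + 2) = (Polynomial.X - C (a (n + 1))) * q (n + 1) - C (b (n + 1)) * q n) (hb : ∀ j, 0 < b j)
    {t : ℕ} (ha : ∀ i, i ≤ t → a i ≤ 0) {x : Fin (t + 1) → ℝ} (hx : StrictMono x) (hxq : q (t + 1) = ∏ j, (Polynomial.X - C (x j))) :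
    x (Fin.last t) ≤ -x 0 := by
  obtain ⟨h0, h1, h2, h3⟩ := recurrence_reflect_spec hq0 hq1 hrec
  have h := neg_bottom_zero_le_top_zero (q := fun n => C ((-1 : ℝ) ^ n) * (q n).comp (C (-1 : ℝ)⁻¹ * Polynomial.X)) (a := fun n => -a n)
    h0 h1 h2 hb (fun i hi => by linarith [ha i hi]) (strictMono_neg_comp_rev hx) (h3 hxq)
  simp only [Fin.rev_zero, Fin.rev_last] at h
  linarith

end Summit.Ventures.HSemireg.Wedge.HankelOuter
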